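import Summits.ABC.IUTFork.Conditional.RefBandsExact110330191652531040475
import Summits.ABC.IUTFork.Conditional.RefBandsExact115966796875
import Summits.ABC.IUTFork.Conditional.RefBandsExact12130039035706446400
import Summits.ABC.IUTFork.Conditional.RefBandsExact12304697054518521
import Summits.ABC.IUTFork.Conditional.AbcOfSGenuineMHullCellsTriple
import Summits.ABC.IUTFork.Cor312ThetaSideAssemblyM
import HarnessLib

/-!
# M LINE twins of the K-line «W:REF-BANDS-EXACT» refutations (4 K files, 4 theorems) — row «W:REF-EXACT-M-TWIN»

PROOF-ONLY file (D-0012; 0 definitions, 0 `Prop` facts, no instance) of the abc-iut cell — D-0079 RESCUE sub-cell R-W «WINDOW Θ-SIDE INEQUALITY», seat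
abc-iut-W-neg-1 (gen 6), row «W:REF-EXACT-M-TWIN» (the residue of `plan/rescue/R-W/M-TWIN-GAP.tsv`: K-line REFUTED exact levels / bands decided by the
HULL-CELL engine without an M twin). TAKES NO SIDE on [IUTchIII] Cor. 3.12 (S. Mochizuki, *Inter-universal Teichmüller theory III*, Cor. 3.12 p. 173–174;
Step (xi-f) p. 184) or on any author; «refuted as typed» ≠ «refuted in print».

GENERATED (this seat's `gen_mtwin.py`): for each K theorem `GenuineK.not_pilotKummerCompatHull_chosen_triple_<tag>` of
`RefBandsExact110330191652531040475`, `RefBandsExact115966796875`, `RefBandsExact12130039035706446400`, `RefBandsExact12304697054518521`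
(REF-BANDS-EXACT, abc-iut-W-num-6 / abc-iut-W-neg-1 lineages; proofs = one call of this seat's K engine
`GenuineK.not_pilotKummerCompatHull_chosen_triple_of_hullCells_tame[Sharp]` on the file's integer cell lemma `RefBand.cells_…`), the M twin
`GenuineM.not_pilotKummerCompatHull_triple_<tag>`: SAME level binders, SAME integer cells BY NAME (no number re-derived; only the local `v_p(abc)`
evaluation is repeated), SAME binders (the M-line place over the pole `p` is `placeOfPrimeQ p`, `ratChar_placeOfPrimeQ`), conclusion = the M books'
per-datum S_H object (`¬ Cor312Vol.PilotKummerCompatHull … (settingPrVolSharpM T.D … (tOfIdeleData T.D (ideleDataOf T.D T.isVolumeInputOf)) …) … qK`,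
the binder `hSHw` of `Conditional.abc_of_SH_v11M_window` / `…_szpiroBadAll`) FAILING for every context / Kummer binder — through file 2 of the row,
`GenuineM.not_pilotKummerCompatHull_triple_of_hullCells_tameSharp` (`AbcOfSGenuineMHullCellsTriple`; a `…_tame` consumer feeds the sharp engine by
ignoring the two Tate clauses). Theorems: `GenuineM.not_pilotKummerCompatHull_triple_110330191652531040475_band`, `GenuineM.not_pilotKummerCompatHull_triple_115966796875_band`, `GenuineM.not_pilotKummerCompatHull_triple_12130039035706446400_band`, `GenuineM.not_pilotKummerCompatHull_triple_12304697054518521_band`.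
READING (neutral; numbers, not adjectives): at these (triple, l) the M books' S_H object fails at EVERY genuine datum, exactly as the K books' does;
admissibility / Szpiro-badness / (P6) / NON-EMPTINESS NOT claimed; the explicit hypothesis counts of the record books are UNCHANGED. HONEST SCOPE: OUR
sharp containers and Dupuy–Hilado's typed (Ind1)/(Ind2); STRONGER-THAN-PRINT set-level reading of Step (xi-f); nothing about the printed GLOBAL
inequality, the number-level `Cor22.Cor312AtDatum` or any author's intended hull; typed ≠ proved; instantiated ≠ endorsed; no abc claim.
[cite: Mochizuki2012, IUTchI Def. 3.1 (e) p. 62, Ex. 3.2 (iv) p. 67; IUTchIII Cor. 3.12 Step (xi-f) p. 184; IUTchIV Prop. 1.1 p. 9, Prop. 1.2 (i)(ii) p. 10, Cor. 2.2 (ii) proof (P5) p. 46]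
[cite: DupuyHilado2025, §3.3, §3.4, §4.9, §4.12] [claim: Mochizuki2012, status: disputed] for every IUT sentence.
-/

noncomputable section

open Set Function Metric NumberField IsDedekindDomain

namespace Summit.ABC.IUTFork.Conditional

open Thm311 Thm311.Real Cor312 Cor312Vol Cor312Prov Literature.IUT.LogThetaLattice Literature.IUT.LogVolume
  Literature.IUT.HodgeTheaters Literature.IUT.LogVolume.ThetaData Literature.IUT.LogVolume.Cor22
open Literature.NumberTheory.NumberFields Literature.NumberTheory.GaloisRepresentations.Ultrametric
open Literature.NumberTheory.DiophantineGeometry Literature.NumberTheory.DiophantineGeometry.GenEll Summit.ABC.ABC.Theorems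
open Summit.ABC.IUTFork.Repair.RH.HullThresholdExact

/-- **R-W «W:REF-BANDS-EXACT» — the triple `5 ^ 2 * 23 ^ 10 * 106531 + 7 ^ 11 * 11 ^ 3 * 193 ^ 4 = 2 ^ 4 * 3 ^ 19 * 17 ^ 8 * 29` REFUTED (S_H level) at EVERY prime `7 ≤ l ≤ 2051837`, `l ≠ 23`, UNCONDITIONALLY
and UNIFORMLY in `l`.** For every such prime `l` and EVERY genuine Θ-volume datum `T` over `(ratPoint (a/c), l)` ([IUTchIV] Cor. 2.2 (ii) proof (P7)),
`Cor312Vol.PilotKummerCompatHull` at `settingPrVolSharp (pilotDataOfK T.D T.K) …` with the CHOSEN realising ideles and the PINNED reading FAILS for every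
choice of the free context binders and Kummer datum: abc-iut-W-neg-1's engine at `p = 23` (`23 ∉ {2,3,5,l}`, `23^10 ∥ abc`, kernel class `A ∈ {3}`),
top label, `RefBand.cells_110330191652531040475`. [cite: Mochizuki2012, IUTchIII Cor. 3.12 Step (xi-f) p. 184; IUTchIV Thm. 1.10 p. 22, Cor. 2.2 (ii) proof (P5) p. 46]
[cite: DupuyHilado2025, §3.4, §4.9, §4.12] [claim: Mochizuki2012, status: disputed]  — **M-LINE TWIN** («W:REF-EXACT-M-TWIN»): SAME cells BY NAME (`RefBandsExact110330191652531040475`) through `GenuineM.not_pilotKummerCompatHull_triple_of_hullCells_tameSharp`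
⟹ S_H FAILS at the M-level setting of `T`'s own ideles (pinned reading), every context / Kummer binder; refuted-as-typed only. -/
theorem GenuineM.not_pilotKummerCompatHull_triple_110330191652531040475_band {l : ℕ} (hl : l.Prime) (hlo : 7 ≤ l) (hhi : l ≤ 2051837) (hne : l ≠ 23)
    (T : Cor22.ThetaVolumeDatumAt (ratPoint (((5 ^ 2 * 23 ^ 10 * 106531 : ℕ) : ℚ) / (2 ^ 4 * 3 ^ 19 * 17 ^ 8 * 29 : ℕ))) l) :
    letI := T.instFieldF; letI := T.instNumberFieldF; letI := T.instAlgebraF; letI := T.instFieldK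
    letI := T.instNumberFieldK; letI := T.instAlgebraK; letI := T.instFieldFbar; letI := T.instAlgebraFbar
    letI := T.instAlgebraKFbar; letI := T.instIsElliptic
    ∀ (M : Type) [Field M] [NumberField M]
      (archPk : ∀ (j : (thetaIndexOfInitial T.D).Label) (vQ : (thetaIndexOfInitial T.D).VQ),
        Set ((logShellsOfInitialDH T.D (analyticLogvVal T.K)).Packet j vQ))
      (archSub : ∀ (j : (thetaIndexOfInitial T.D).Label) (v : (thetaIndexOfInitial T.D).V),
        Set ((logShellsOfInitialDH T.D (analyticLogvVal T.K)).Packet j ((thetaIndexOfInitial T.D).over v)))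
      (Ψ : ℤ → ∀ v : (thetaIndexOfInitial T.D).V, v ∈ (thetaIndexOfInitial T.D).Vbad →
        Set ((logShellsOfInitialDH T.D (analyticLogvVal T.K)).StarPacket v))
      (act : ℤ → ∀ v : (thetaIndexOfInitial T.D).V, v ∈ (thetaIndexOfInitial T.D).Vbad →
        (logShellsOfInitialDH T.D (analyticLogvVal T.K)).StarPacket v →
          Module.End ℚ ((logShellsOfInitialDH T.D (analyticLogvVal T.K)).StarPacket v))
      (Mmod : ℤ → ∀ j : (thetaIndexOfInitial T.D).LabelStar, Set ((logShellsOfInitialDH T.D (analyticLogvVal T.K)).GlobalPacket j.1))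
      (region : ℤ → ∀ j : (thetaIndexOfInitial T.D).LabelStar, FinDivisor M → ∀ vQ : (thetaIndexOfInitial T.D).VQ,
        Set ((logShellsOfInitialDH T.D (analyticLogvVal T.K)).Packet j.1 vQ))
      (frobAdm : ℤ → ℤ → ∀ (j : (thetaIndexOfInitial T.D).Label) (vQ : (thetaIndexOfInitial T.D).VQ),
        Set ((logShellsOfInitialDH T.D (analyticLogvVal T.K)).Packet j vQ) → Prop)
      (frobLogvol : ℤ → ℤ → ∀ (j : (thetaIndexOfInitial T.D).Label) (vQ : (thetaIndexOfInitial T.D).VQ),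
        Set ((logShellsOfInitialDH T.D (analyticLogvVal T.K)).Packet j vQ) → ℝ)
      (frobΨ : ℤ → ℤ → ∀ v : (thetaIndexOfInitial T.D).V, v ∈ (thetaIndexOfInitial T.D).Vbad →
        Set ((logShellsOfInitialDH T.D (analyticLogvVal T.K)).StarPacket v))
      (frobMmod : ℤ → ℤ → ∀ j : (thetaIndexOfInitial T.D).LabelStar, Set ((logShellsOfInitialDH T.D (analyticLogvVal T.K)).GlobalPacket j.1))
      (unitImage : ℤ → ℤ → ℕ → ∀ (j : (thetaIndexOfInitial T.D).Label) (vQ : (thetaIndexOfInitial T.D).VQ),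
        Set ((logShellsOfInitialDH T.D (analyticLogvVal T.K)).Packet j vQ))
      (ballImage : ℤ → ℤ → ∀ (j : (thetaIndexOfInitial T.D).Label) (vQ : (thetaIndexOfInitial T.D).VQ),
        Set ((logShellsOfInitialDH T.D (analyticLogvVal T.K)).Packet j vQ))
      (thetaDiv : ℤ → ℤ → LgpDivisor M (thetaIndexOfInitial T.D).lstar)
      (n : ℤ) {HT : Type} {LogLink : HT → HT → Type} {IsFull : ∀ {s t : HT}, LogLink s t → Prop}
      (lat : LGPGaussianLogThetaLattice LogLink IsFull)
      {Frd : Type} {IsoF : Frd → Frd → Type} {Ob : Frd → Type} {realify : Frd → Frd} {Strip : Type}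
      {IsoS : Strip → Strip → Type} {Mv : ∀ v : (thetaIndexOfInitial T.D).V, v ∈ (thetaIndexOfInitial T.D).Vbad → Type}
      [∀ v h, Monoid (Mv v h)]
      (sig : GlobalLGPFrobenioidSignature (thetaIndexOfInitial T.D).lstar (thetaIndexOfInitial T.D).V
        (· ∈ (thetaIndexOfInitial T.D).Vbad) Frd IsoF Ob realify Strip IsoS Mv)
      (split : SplittingMonoids Mv) {ObΔ : Type} {N : ∀ v : (thetaIndexOfInitial T.D).V, v ∈ (thetaIndexOfInitial T.D).Vbad → Type}
      [∀ v h, Monoid (N v h)] (qData : QPilotData ObΔ N)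
      (qK : ∀ v : (thetaIndexOfInitial T.D).V, v ∈ (thetaIndexOfInitial T.D).Vbad →
        Set ((logShellsOfInitialDH T.D (analyticLogvVal T.K)).StarPacket v)),
      ¬ Cor312Vol.PilotKummerCompatHull
        (LatticeSituation.ofShells (logShellsOfInitialDH T.D (analyticLogvVal T.K)) M archPk archSub
          (summandPiecesPrM T.D (logvAnalyticVal_analyticLogvVal (K := T.K))).Adm (summandPiecesPrM T.D (logvAnalyticVal_analyticLogvVal (K := T.K))).logvol Ψ act Mmod region frobAdm frobLogvol
          frobΨ frobMmod unitImage ballImage thetaDiv)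
        (settingPrVolSharpM T.D (logvAnalyticVal_analyticLogvVal (K := T.K)) (tOfIdeleData T.D (ideleDataOf T.D T.isVolumeInputOf))
          (fun u x => tqM T.D (ratChar u) u (natCast_ratChar_mem u) (ideleDataOf T.D T.isVolumeInputOf) x) M archPk archSub Ψ act Mmod region n lat sig split qData
          (fun u x => tqM_ne_zero T.D (ratChar u) u (natCast_ratChar_mem u) (ideleDataOf T.D T.isVolumeInputOf) x)
          (GenuineM.finite_ratPlaces_under_S T.D).toFinset
          (fun u x hu => norm_tqM_eq_one_of_not_mem T.D (ratChar u) u (natCast_ratChar_mem u) (ideleDataOf T.D T.isVolumeInputOf) x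
            fun hx => hu ((Set.Finite.mem_toFinset _).mpr ⟨x, hx⟩)))
        (fun _ => Cor312.Setting.qRegion
          (settingPrVolSharpM T.D (logvAnalyticVal_analyticLogvVal (K := T.K)) (tOfIdeleData T.D (ideleDataOf T.D T.isVolumeInputOf))
          (fun u x => tqM T.D (ratChar u) u (natCast_ratChar_mem u) (ideleDataOf T.D T.isVolumeInputOf) x) M archPk archSub Ψ act Mmod region n lat sig split qData
          (fun u x => tqM_ne_zero T.D (ratChar u) u (natCast_ratChar_mem u) (ideleDataOf T.D T.isVolumeInputOf) x)
          (GenuineM.finite_ratPlaces_under_S T.D).toFinset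
          (fun u x hu => norm_tqM_eq_one_of_not_mem T.D (ratChar u) u (natCast_ratChar_mem u) (ideleDataOf T.D T.isVolumeInputOf) x
            fun hx => hu ((Set.Finite.mem_toFinset _).mpr ⟨x, hx⟩)))) qK := by
  have hodd : Odd l := hl.odd_of_ne_two (by omega)
  have hfac : (5 ^ 2 * 23 ^ 10 * 106531 * (7 ^ 11 * 11 ^ 3 * 193 ^ 4) * (2 ^ 4 * 3 ^ 19 * 17 ^ 8 * 29)).factorization 23 = 10 := by
    have hp : Nat.Prime 23 := by norm_num
    have hn : 5 ^ 2 * 23 ^ 10 * 106531 * (7 ^ 11 * 11 ^ 3 * 193 ^ 4) * (2 ^ 4 * 3 ^ 19 * 17 ^ 8 * 29) = 23 ^ 10 * 36586000445119312822719881566734058223379897939600 := by norm_num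
    have hm : ¬ 23 ∣ 36586000445119312822719881566734058223379897939600 := by norm_num
    show (5 ^ 2 * 23 ^ 10 * 106531 * (7 ^ 11 * 11 ^ 3 * 193 ^ 4) * (2 ^ 4 * 3 ^ 19 * 17 ^ 8 * 29)).factorization 23 = 10
    rw [hn, Nat.factorization_mul (pow_ne_zero _ hp.ne_zero) (by norm_num), Finsupp.add_apply, hp.factorization_pow,
      Finsupp.single_eq_same, Nat.factorization_eq_zero_of_not_dvd hm, add_zero]
  exact GenuineM.not_pilotKummerCompatHull_triple_of_hullCells_tameSharp isABCTriple_frey110330191652531040475 T (placeOfPrimeQ 23 (by norm_num)) 23 (ratChar_placeOfPrimeQ 23 (by norm_num)) (by norm_num) (by norm_num)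
    (by norm_num) (show (23 : ℕ) ≠ l by omega) (by norm_num) hfac (i := (l - 1) / 2 - 1) (by omega)
    (fun A hA30 hA15 hAev hA3 hA5 => RefBand.cells_110330191652531040475 hlo hhi hodd (by omega) A hA30 hA15 hAev hA3 hA5)

/-- **R-W «W:REF-BANDS-EXACT» — the triple `5 ^ 14 * 19 + 2 ^ 5 * 3 * 7 ^ 13 = 11 ^ 7 * 37 ^ 2 * 353` REFUTED (S_H level) at EVERY prime `7 ≤ l ≤ 5853`, `l ≠ 7`, UNCONDITIONALLY
and UNIFORMLY in `l`.** For every such prime `l` and EVERY genuine Θ-volume datum `T` over `(ratPoint (a/c), l)` ([IUTchIV] Cor. 2.2 (ii) proof (P7)),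
`Cor312Vol.PilotKummerCompatHull` at `settingPrVolSharp (pilotDataOfK T.D T.K) …` with the CHOSEN realising ideles and the PINNED reading FAILS for every
choice of the free context binders and Kummer datum: abc-iut-W-neg-1's engine at `p = 7` (`7 ∉ {2,3,5,l}`, `7^13 ∥ abc`, kernel class `A ∈ {15, 30}`),
top label, `RefBand.cells_115966796875`. [cite: Mochizuki2012, IUTchIII Cor. 3.12 Step (xi-f) p. 184; IUTchIV Thm. 1.10 p. 22, Cor. 2.2 (ii) proof (P5) p. 46]
[cite: DupuyHilado2025, §3.4, §4.9, §4.12] [claim: Mochizuki2012, status: disputed]  — **M-LINE TWIN** («W:REF-EXACT-M-TWIN»): SAME cells BY NAME (`RefBandsExact115966796875`) through `GenuineM.not_pilotKummerCompatHull_triple_of_hullCells_tameSharp`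
⟹ S_H FAILS at the M-level setting of `T`'s own ideles (pinned reading), every context / Kummer binder; refuted-as-typed only. -/
theorem GenuineM.not_pilotKummerCompatHull_triple_115966796875_band {l : ℕ} (hl : l.Prime) (hlo : 7 ≤ l) (hhi : l ≤ 5853) (hne : l ≠ 7)
    (T : Cor22.ThetaVolumeDatumAt (ratPoint (((5 ^ 14 * 19 : ℕ) : ℚ) / (11 ^ 7 * 37 ^ 2 * 353 : ℕ))) l) :
    letI := T.instFieldF; letI := T.instNumberFieldF; letI := T.instAlgebraF; letI := T.instFieldK
    letI := T.instNumberFieldK; letI := T.instAlgebraK; letI := T.instFieldFbar; letI := T.instAlgebraFbar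
    letI := T.instAlgebraKFbar; letI := T.instIsElliptic
    ∀ (M : Type) [Field M] [NumberField M]
      (archPk : ∀ (j : (thetaIndexOfInitial T.D).Label) (vQ : (thetaIndexOfInitial T.D).VQ),
        Set ((logShellsOfInitialDH T.D (analyticLogvVal T.K)).Packet j vQ))
      (archSub : ∀ (j : (thetaIndexOfInitial T.D).Label) (v : (thetaIndexOfInitial T.D).V),
        Set ((logShellsOfInitialDH T.D (analyticLogvVal T.K)).Packet j ((thetaIndexOfInitial T.D).over v)))
      (Ψ : ℤ → ∀ v : (thetaIndexOfInitial T.D).V, v ∈ (thetaIndexOfInitial T.D).Vbad →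
        Set ((logShellsOfInitialDH T.D (analyticLogvVal T.K)).StarPacket v))
      (act : ℤ → ∀ v : (thetaIndexOfInitial T.D).V, v ∈ (thetaIndexOfInitial T.D).Vbad →
        (logShellsOfInitialDH T.D (analyticLogvVal T.K)).StarPacket v →
          Module.End ℚ ((logShellsOfInitialDH T.D (analyticLogvVal T.K)).StarPacket v))
      (Mmod : ℤ → ∀ j : (thetaIndexOfInitial T.D).LabelStar, Set ((logShellsOfInitialDH T.D (analyticLogvVal T.K)).GlobalPacket j.1))
      (region : ℤ → ∀ j : (thetaIndexOfInitial T.D).LabelStar, FinDivisor M → ∀ vQ : (thetaIndexOfInitial T.D).VQ,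
        Set ((logShellsOfInitialDH T.D (analyticLogvVal T.K)).Packet j.1 vQ))
      (frobAdm : ℤ → ℤ → ∀ (j : (thetaIndexOfInitial T.D).Label) (vQ : (thetaIndexOfInitial T.D).VQ),
        Set ((logShellsOfInitialDH T.D (analyticLogvVal T.K)).Packet j vQ) → Prop)
      (frobLogvol : ℤ → ℤ → ∀ (j : (thetaIndexOfInitial T.D).Label) (vQ : (thetaIndexOfInitial T.D).VQ),
        Set ((logShellsOfInitialDH T.D (analyticLogvVal T.K)).Packet j vQ) → ℝ)
      (frobΨ : ℤ → ℤ → ∀ v : (thetaIndexOfInitial T.D).V, v ∈ (thetaIndexOfInitial T.D).Vbad →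
        Set ((logShellsOfInitialDH T.D (analyticLogvVal T.K)).StarPacket v))
      (frobMmod : ℤ → ℤ → ∀ j : (thetaIndexOfInitial T.D).LabelStar, Set ((logShellsOfInitialDH T.D (analyticLogvVal T.K)).GlobalPacket j.1))
      (unitImage : ℤ → ℤ → ℕ → ∀ (j : (thetaIndexOfInitial T.D).Label) (vQ : (thetaIndexOfInitial T.D).VQ),
        Set ((logShellsOfInitialDH T.D (analyticLogvVal T.K)).Packet j vQ))
      (ballImage : ℤ → ℤ → ∀ (j : (thetaIndexOfInitial T.D).Label) (vQ : (thetaIndexOfInitial T.D).VQ),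
        Set ((logShellsOfInitialDH T.D (analyticLogvVal T.K)).Packet j vQ))
      (thetaDiv : ℤ → ℤ → LgpDivisor M (thetaIndexOfInitial T.D).lstar)
      (n : ℤ) {HT : Type} {LogLink : HT → HT → Type} {IsFull : ∀ {s t : HT}, LogLink s t → Prop}
      (lat : LGPGaussianLogThetaLattice LogLink IsFull)
      {Frd : Type} {IsoF : Frd → Frd → Type} {Ob : Frd → Type} {realify : Frd → Frd} {Strip : Type}
      {IsoS : Strip → Strip → Type} {Mv : ∀ v : (thetaIndexOfInitial T.D).V, v ∈ (thetaIndexOfInitial T.D).Vbad → Type}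
      [∀ v h, Monoid (Mv v h)]
      (sig : GlobalLGPFrobenioidSignature (thetaIndexOfInitial T.D).lstar (thetaIndexOfInitial T.D).V
        (· ∈ (thetaIndexOfInitial T.D).Vbad) Frd IsoF Ob realify Strip IsoS Mv)
      (split : SplittingMonoids Mv) {ObΔ : Type} {N : ∀ v : (thetaIndexOfInitial T.D).V, v ∈ (thetaIndexOfInitial T.D).Vbad → Type}
      [∀ v h, Monoid (N v h)] (qData : QPilotData ObΔ N)
      (qK : ∀ v : (thetaIndexOfInitial T.D).V, v ∈ (thetaIndexOfInitial T.D).Vbad →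
        Set ((logShellsOfInitialDH T.D (analyticLogvVal T.K)).StarPacket v)),
      ¬ Cor312Vol.PilotKummerCompatHull
        (LatticeSituation.ofShells (logShellsOfInitialDH T.D (analyticLogvVal T.K)) M archPk archSub
          (summandPiecesPrM T.D (logvAnalyticVal_analyticLogvVal (K := T.K))).Adm (summandPiecesPrM T.D (logvAnalyticVal_analyticLogvVal (K := T.K))).logvol Ψ act Mmod region frobAdm frobLogvol
          frobΨ frobMmod unitImage ballImage thetaDiv)
        (settingPrVolSharpM T.D (logvAnalyticVal_analyticLogvVal (K := T.K)) (tOfIdeleData T.D (ideleDataOf T.D T.isVolumeInputOf))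
          (fun u x => tqM T.D (ratChar u) u (natCast_ratChar_mem u) (ideleDataOf T.D T.isVolumeInputOf) x) M archPk archSub Ψ act Mmod region n lat sig split qData
          (fun u x => tqM_ne_zero T.D (ratChar u) u (natCast_ratChar_mem u) (ideleDataOf T.D T.isVolumeInputOf) x)
          (GenuineM.finite_ratPlaces_under_S T.D).toFinset
          (fun u x hu => norm_tqM_eq_one_of_not_mem T.D (ratChar u) u (natCast_ratChar_mem u) (ideleDataOf T.D T.isVolumeInputOf) x
            fun hx => hu ((Set.Finite.mem_toFinset _).mpr ⟨x, hx⟩)))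
        (fun _ => Cor312.Setting.qRegion
          (settingPrVolSharpM T.D (logvAnalyticVal_analyticLogvVal (K := T.K)) (tOfIdeleData T.D (ideleDataOf T.D T.isVolumeInputOf))
          (fun u x => tqM T.D (ratChar u) u (natCast_ratChar_mem u) (ideleDataOf T.D T.isVolumeInputOf) x) M archPk archSub Ψ act Mmod region n lat sig split qData
          (fun u x => tqM_ne_zero T.D (ratChar u) u (natCast_ratChar_mem u) (ideleDataOf T.D T.isVolumeInputOf) x)
          (GenuineM.finite_ratPlaces_under_S T.D).toFinset
          (fun u x hu => norm_tqM_eq_one_of_not_mem T.D (ratChar u) u (natCast_ratChar_mem u) (ideleDataOf T.D T.isVolumeInputOf) x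
            fun hx => hu ((Set.Finite.mem_toFinset _).mpr ⟨x, hx⟩)))) qK := by
  have hodd : Odd l := hl.odd_of_ne_two (by omega)
  have hfac : (5 ^ 14 * 19 * (2 ^ 5 * 3 * 7 ^ 13) * (11 ^ 7 * 37 ^ 2 * 353)).factorization 7 = 13 := by
    have hp : Nat.Prime 7 := by norm_num
    have hn : 5 ^ 14 * 19 * (2 ^ 5 * 3 * 7 ^ 13) * (11 ^ 7 * 37 ^ 2 * 353) = 7 ^ 13 * 104841166478316210937500000 := by norm_num
    have hm : ¬ 7 ∣ 104841166478316210937500000 := by norm_num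
    show (5 ^ 14 * 19 * (2 ^ 5 * 3 * 7 ^ 13) * (11 ^ 7 * 37 ^ 2 * 353)).factorization 7 = 13
    rw [hn, Nat.factorization_mul (pow_ne_zero _ hp.ne_zero) (by norm_num), Finsupp.add_apply, hp.factorization_pow,
      Finsupp.single_eq_same, Nat.factorization_eq_zero_of_not_dvd hm, add_zero]
  exact GenuineM.not_pilotKummerCompatHull_triple_of_hullCells_tameSharp isABCTriple_frey115966796875 T (placeOfPrimeQ 7 (by norm_num)) 7 (ratChar_placeOfPrimeQ 7 (by norm_num)) (by norm_num) (by norm_num)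
    (by norm_num) (show (7 : ℕ) ≠ l by omega) (by norm_num) hfac (i := (l - 1) / 2 - 1) (by omega)
    (fun A hA30 hA15 hAev _ _ => RefBand.cells_115966796875 hlo hhi hodd (by omega) A hA30 hA15 hAev)

/-- **R-W «W:REF-BANDS-EXACT» — the triple `2 ^ 6 * 5 ^ 2 * 7 ^ 13 * 13 ^ 2 * 463 + 3 ^ 4 * 43 ^ 12 = 11 ^ 12 * 389 ^ 2 * 6841` REFUTED (S_H level) at EVERY prime `7 ≤ l ≤ 1234870165`, `l ≠ 43`, UNCONDITIONALLY
and UNIFORMLY in `l`.** For every such prime `l` and EVERY genuine Θ-volume datum `T` over `(ratPoint (a/c), l)` ([IUTchIV] Cor. 2.2 (ii) proof (P7)),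
`Cor312Vol.PilotKummerCompatHull` at `settingPrVolSharp (pilotDataOfK T.D T.K) …` with the CHOSEN realising ideles and the PINNED reading FAILS for every
choice of the free context binders and Kummer datum: abc-iut-W-neg-1's engine at `p = 43` (`43 ∉ {2,3,5,l}`, `43^12 ∥ abc`, kernel class `A ∈ {5}`),
top label, `RefBand.cells_12130039035706446400`. [cite: Mochizuki2012, IUTchIII Cor. 3.12 Step (xi-f) p. 184; IUTchIV Thm. 1.10 p. 22, Cor. 2.2 (ii) proof (P5) p. 46]
[cite: DupuyHilado2025, §3.4, §4.9, §4.12] [claim: Mochizuki2012, status: disputed]  — **M-LINE TWIN** («W:REF-EXACT-M-TWIN»): SAME cells BY NAME (`RefBandsExact12130039035706446400`) through `GenuineM.not_pilotKummerCompatHull_triple_of_hullCells_tameSharp`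
⟹ S_H FAILS at the M-level setting of `T`'s own ideles (pinned reading), every context / Kummer binder; refuted-as-typed only. -/
theorem GenuineM.not_pilotKummerCompatHull_triple_12130039035706446400_band {l : ℕ} (hl : l.Prime) (hlo : 7 ≤ l) (hhi : l ≤ 1234870165) (hne : l ≠ 43)
    (T : Cor22.ThetaVolumeDatumAt (ratPoint (((2 ^ 6 * 5 ^ 2 * 7 ^ 13 * 13 ^ 2 * 463 : ℕ) : ℚ) / (11 ^ 12 * 389 ^ 2 * 6841 : ℕ))) l) :
    letI := T.instFieldF; letI := T.instNumberFieldF; letI := T.instAlgebraF; letI := T.instFieldK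
    letI := T.instNumberFieldK; letI := T.instAlgebraK; letI := T.instFieldFbar; letI := T.instAlgebraFbar
    letI := T.instAlgebraKFbar; letI := T.instIsElliptic
    ∀ (M : Type) [Field M] [NumberField M]
      (archPk : ∀ (j : (thetaIndexOfInitial T.D).Label) (vQ : (thetaIndexOfInitial T.D).VQ),
        Set ((logShellsOfInitialDH T.D (analyticLogvVal T.K)).Packet j vQ))
      (archSub : ∀ (j : (thetaIndexOfInitial T.D).Label) (v : (thetaIndexOfInitial T.D).V),
        Set ((logShellsOfInitialDH T.D (analyticLogvVal T.K)).Packet j ((thetaIndexOfInitial T.D).over v)))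
      (Ψ : ℤ → ∀ v : (thetaIndexOfInitial T.D).V, v ∈ (thetaIndexOfInitial T.D).Vbad →
        Set ((logShellsOfInitialDH T.D (analyticLogvVal T.K)).StarPacket v))
      (act : ℤ → ∀ v : (thetaIndexOfInitial T.D).V, v ∈ (thetaIndexOfInitial T.D).Vbad →
        (logShellsOfInitialDH T.D (analyticLogvVal T.K)).StarPacket v →
          Module.End ℚ ((logShellsOfInitialDH T.D (analyticLogvVal T.K)).StarPacket v))
      (Mmod : ℤ → ∀ j : (thetaIndexOfInitial T.D).LabelStar, Set ((logShellsOfInitialDH T.D (analyticLogvVal T.K)).GlobalPacket j.1))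
      (region : ℤ → ∀ j : (thetaIndexOfInitial T.D).LabelStar, FinDivisor M → ∀ vQ : (thetaIndexOfInitial T.D).VQ,
        Set ((logShellsOfInitialDH T.D (analyticLogvVal T.K)).Packet j.1 vQ))
      (frobAdm : ℤ → ℤ → ∀ (j : (thetaIndexOfInitial T.D).Label) (vQ : (thetaIndexOfInitial T.D).VQ),
        Set ((logShellsOfInitialDH T.D (analyticLogvVal T.K)).Packet j vQ) → Prop)
      (frobLogvol : ℤ → ℤ → ∀ (j : (thetaIndexOfInitial T.D).Label) (vQ : (thetaIndexOfInitial T.D).VQ),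
        Set ((logShellsOfInitialDH T.D (analyticLogvVal T.K)).Packet j vQ) → ℝ)
      (frobΨ : ℤ → ℤ → ∀ v : (thetaIndexOfInitial T.D).V, v ∈ (thetaIndexOfInitial T.D).Vbad →
        Set ((logShellsOfInitialDH T.D (analyticLogvVal T.K)).StarPacket v))
      (frobMmod : ℤ → ℤ → ∀ j : (thetaIndexOfInitial T.D).LabelStar, Set ((logShellsOfInitialDH T.D (analyticLogvVal T.K)).GlobalPacket j.1))
      (unitImage : ℤ → ℤ → ℕ → ∀ (j : (thetaIndexOfInitial T.D).Label) (vQ : (thetaIndexOfInitial T.D).VQ),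
        Set ((logShellsOfInitialDH T.D (analyticLogvVal T.K)).Packet j vQ))
      (ballImage : ℤ → ℤ → ∀ (j : (thetaIndexOfInitial T.D).Label) (vQ : (thetaIndexOfInitial T.D).VQ),
        Set ((logShellsOfInitialDH T.D (analyticLogvVal T.K)).Packet j vQ))
      (thetaDiv : ℤ → ℤ → LgpDivisor M (thetaIndexOfInitial T.D).lstar)
      (n : ℤ) {HT : Type} {LogLink : HT → HT → Type} {IsFull : ∀ {s t : HT}, LogLink s t → Prop}
      (lat : LGPGaussianLogThetaLattice LogLink IsFull)
      {Frd : Type} {IsoF : Frd → Frd → Type} {Ob : Frd → Type} {realify : Frd → Frd} {Strip : Type}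
      {IsoS : Strip → Strip → Type} {Mv : ∀ v : (thetaIndexOfInitial T.D).V, v ∈ (thetaIndexOfInitial T.D).Vbad → Type}
      [∀ v h, Monoid (Mv v h)]
      (sig : GlobalLGPFrobenioidSignature (thetaIndexOfInitial T.D).lstar (thetaIndexOfInitial T.D).V
        (· ∈ (thetaIndexOfInitial T.D).Vbad) Frd IsoF Ob realify Strip IsoS Mv)
      (split : SplittingMonoids Mv) {ObΔ : Type} {N : ∀ v : (thetaIndexOfInitial T.D).V, v ∈ (thetaIndexOfInitial T.D).Vbad → Type}
      [∀ v h, Monoid (N v h)] (qData : QPilotData ObΔ N)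
      (qK : ∀ v : (thetaIndexOfInitial T.D).V, v ∈ (thetaIndexOfInitial T.D).Vbad →
        Set ((logShellsOfInitialDH T.D (analyticLogvVal T.K)).StarPacket v)),
      ¬ Cor312Vol.PilotKummerCompatHull
        (LatticeSituation.ofShells (logShellsOfInitialDH T.D (analyticLogvVal T.K)) M archPk archSub
          (summandPiecesPrM T.D (logvAnalyticVal_analyticLogvVal (K := T.K))).Adm (summandPiecesPrM T.D (logvAnalyticVal_analyticLogvVal (K := T.K))).logvol Ψ act Mmod region frobAdm frobLogvol
          frobΨ frobMmod unitImage ballImage thetaDiv)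
        (settingPrVolSharpM T.D (logvAnalyticVal_analyticLogvVal (K := T.K)) (tOfIdeleData T.D (ideleDataOf T.D T.isVolumeInputOf))
          (fun u x => tqM T.D (ratChar u) u (natCast_ratChar_mem u) (ideleDataOf T.D T.isVolumeInputOf) x) M archPk archSub Ψ act Mmod region n lat sig split qData
          (fun u x => tqM_ne_zero T.D (ratChar u) u (natCast_ratChar_mem u) (ideleDataOf T.D T.isVolumeInputOf) x)
          (GenuineM.finite_ratPlaces_under_S T.D).toFinset
          (fun u x hu => norm_tqM_eq_one_of_not_mem T.D (ratChar u) u (natCast_ratChar_mem u) (ideleDataOf T.D T.isVolumeInputOf) x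
            fun hx => hu ((Set.Finite.mem_toFinset _).mpr ⟨x, hx⟩)))
        (fun _ => Cor312.Setting.qRegion
          (settingPrVolSharpM T.D (logvAnalyticVal_analyticLogvVal (K := T.K)) (tOfIdeleData T.D (ideleDataOf T.D T.isVolumeInputOf))
          (fun u x => tqM T.D (ratChar u) u (natCast_ratChar_mem u) (ideleDataOf T.D T.isVolumeInputOf) x) M archPk archSub Ψ act Mmod region n lat sig split qData
          (fun u x => tqM_ne_zero T.D (ratChar u) u (natCast_ratChar_mem u) (ideleDataOf T.D T.isVolumeInputOf) x)
          (GenuineM.finite_ratPlaces_under_S T.D).toFinset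
          (fun u x hu => norm_tqM_eq_one_of_not_mem T.D (ratChar u) u (natCast_ratChar_mem u) (ideleDataOf T.D T.isVolumeInputOf) x
            fun hx => hu ((Set.Finite.mem_toFinset _).mpr ⟨x, hx⟩)))) qK := by
  have hodd : Odd l := hl.odd_of_ne_two (by omega)
  have hfac : (2 ^ 6 * 5 ^ 2 * 7 ^ 13 * 13 ^ 2 * 463 * (3 ^ 4 * 43 ^ 12) * (11 ^ 12 * 389 ^ 2 * 6841)).factorization 43 = 12 := by
    have hp : Nat.Prime 43 := by norm_num
    have hn : 2 ^ 6 * 5 ^ 2 * 7 ^ 13 * 13 ^ 2 * 463 * (3 ^ 4 * 43 ^ 12) * (11 ^ 12 * 389 ^ 2 * 6841) = 43 ^ 12 * 3192112819625326343802803576088456947150400 := by norm_num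
    have hm : ¬ 43 ∣ 3192112819625326343802803576088456947150400 := by norm_num
    show (2 ^ 6 * 5 ^ 2 * 7 ^ 13 * 13 ^ 2 * 463 * (3 ^ 4 * 43 ^ 12) * (11 ^ 12 * 389 ^ 2 * 6841)).factorization 43 = 12
    rw [hn, Nat.factorization_mul (pow_ne_zero _ hp.ne_zero) (by norm_num), Finsupp.add_apply, hp.factorization_pow,
      Finsupp.single_eq_same, Nat.factorization_eq_zero_of_not_dvd hm, add_zero]
  exact GenuineM.not_pilotKummerCompatHull_triple_of_hullCells_tameSharp isABCTriple_frey12130039035706446400 T (placeOfPrimeQ 43 (by norm_num)) 43 (ratChar_placeOfPrimeQ 43 (by norm_num)) (by norm_num) (by norm_num)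
    (by norm_num) (show (43 : ℕ) ≠ l by omega) (by norm_num) hfac (i := (l - 1) / 2 - 1) (by omega)
    (fun A hA30 hA15 hAev hA3 hA5 => RefBand.cells_12130039035706446400 hlo hhi hodd (by omega) A hA30 hA15 hAev hA3 hA5)

/-- **R-W «W:REF-BANDS-EXACT» — the triple `3 ^ 4 * 23 ^ 6 * 1013 ^ 2 + 2 ^ 47 * 5 ^ 3 * 19 ^ 2 = 7 * 131 ^ 7 * 1373` REFUTED (S_H level) at EVERY prime `7 ≤ l ≤ 147581`, `l ≠ 131`, UNCONDITIONALLY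
and UNIFORMLY in `l`.** For every such prime `l` and EVERY genuine Θ-volume datum `T` over `(ratPoint (a/c), l)` ([IUTchIV] Cor. 2.2 (ii) proof (P7)),
`Cor312Vol.PilotKummerCompatHull` at `settingPrVolSharp (pilotDataOfK T.D T.K) …` with the CHOSEN realising ideles and the PINNED reading FAILS for every
choice of the free context binders and Kummer datum: abc-iut-W-neg-1's engine at `p = 131` (`131 ∉ {2,3,5,l}`, `131^7 ∥ abc`, kernel class `A ∈ {15, 30}`),
top label, `RefBand.cells_12304697054518521`. [cite: Mochizuki2012, IUTchIII Cor. 3.12 Step (xi-f) p. 184; IUTchIV Thm. 1.10 p. 22, Cor. 2.2 (ii) proof (P5) p. 46]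
[cite: DupuyHilado2025, §3.4, §4.9, §4.12] [claim: Mochizuki2012, status: disputed]  — **M-LINE TWIN** («W:REF-EXACT-M-TWIN»): SAME cells BY NAME (`RefBandsExact12304697054518521`) through `GenuineM.not_pilotKummerCompatHull_triple_of_hullCells_tameSharp`
⟹ S_H FAILS at the M-level setting of `T`'s own ideles (pinned reading), every context / Kummer binder; refuted-as-typed only. -/
theorem GenuineM.not_pilotKummerCompatHull_triple_12304697054518521_band {l : ℕ} (hl : l.Prime) (hlo : 7 ≤ l) (hhi : l ≤ 147581) (hne : l ≠ 131)
    (T : Cor22.ThetaVolumeDatumAt (ratPoint (((3 ^ 4 * 23 ^ 6 * 1013 ^ 2 : ℕ) : ℚ) / (7 * 131 ^ 7 * 1373 : ℕ))) l) :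
    letI := T.instFieldF; letI := T.instNumberFieldF; letI := T.instAlgebraF; letI := T.instFieldK
    letI := T.instNumberFieldK; letI := T.instAlgebraK; letI := T.instFieldFbar; letI := T.instAlgebraFbar
    letI := T.instAlgebraKFbar; letI := T.instIsElliptic
    ∀ (M : Type) [Field M] [NumberField M]
      (archPk : ∀ (j : (thetaIndexOfInitial T.D).Label) (vQ : (thetaIndexOfInitial T.D).VQ),
        Set ((logShellsOfInitialDH T.D (analyticLogvVal T.K)).Packet j vQ))
      (archSub : ∀ (j : (thetaIndexOfInitial T.D).Label) (v : (thetaIndexOfInitial T.D).V),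
        Set ((logShellsOfInitialDH T.D (analyticLogvVal T.K)).Packet j ((thetaIndexOfInitial T.D).over v)))
      (Ψ : ℤ → ∀ v : (thetaIndexOfInitial T.D).V, v ∈ (thetaIndexOfInitial T.D).Vbad →
        Set ((logShellsOfInitialDH T.D (analyticLogvVal T.K)).StarPacket v))
      (act : ℤ → ∀ v : (thetaIndexOfInitial T.D).V, v ∈ (thetaIndexOfInitial T.D).Vbad →
        (logShellsOfInitialDH T.D (analyticLogvVal T.K)).StarPacket v →
          Module.End ℚ ((logShellsOfInitialDH T.D (analyticLogvVal T.K)).StarPacket v))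
      (Mmod : ℤ → ∀ j : (thetaIndexOfInitial T.D).LabelStar, Set ((logShellsOfInitialDH T.D (analyticLogvVal T.K)).GlobalPacket j.1))
      (region : ℤ → ∀ j : (thetaIndexOfInitial T.D).LabelStar, FinDivisor M → ∀ vQ : (thetaIndexOfInitial T.D).VQ,
        Set ((logShellsOfInitialDH T.D (analyticLogvVal T.K)).Packet j.1 vQ))
      (frobAdm : ℤ → ℤ → ∀ (j : (thetaIndexOfInitial T.D).Label) (vQ : (thetaIndexOfInitial T.D).VQ),
        Set ((logShellsOfInitialDH T.D (analyticLogvVal T.K)).Packet j vQ) → Prop)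
      (frobLogvol : ℤ → ℤ → ∀ (j : (thetaIndexOfInitial T.D).Label) (vQ : (thetaIndexOfInitial T.D).VQ),
        Set ((logShellsOfInitialDH T.D (analyticLogvVal T.K)).Packet j vQ) → ℝ)
      (frobΨ : ℤ → ℤ → ∀ v : (thetaIndexOfInitial T.D).V, v ∈ (thetaIndexOfInitial T.D).Vbad →
        Set ((logShellsOfInitialDH T.D (analyticLogvVal T.K)).StarPacket v))
      (frobMmod : ℤ → ℤ → ∀ j : (thetaIndexOfInitial T.D).LabelStar, Set ((logShellsOfInitialDH T.D (analyticLogvVal T.K)).GlobalPacket j.1))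
      (unitImage : ℤ → ℤ → ℕ → ∀ (j : (thetaIndexOfInitial T.D).Label) (vQ : (thetaIndexOfInitial T.D).VQ),
        Set ((logShellsOfInitialDH T.D (analyticLogvVal T.K)).Packet j vQ))
      (ballImage : ℤ → ℤ → ∀ (j : (thetaIndexOfInitial T.D).Label) (vQ : (thetaIndexOfInitial T.D).VQ),
        Set ((logShellsOfInitialDH T.D (analyticLogvVal T.K)).Packet j vQ))
      (thetaDiv : ℤ → ℤ → LgpDivisor M (thetaIndexOfInitial T.D).lstar)
      (n : ℤ) {HT : Type} {LogLink : HT → HT → Type} {IsFull : ∀ {s t : HT}, LogLink s t → Prop}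
      (lat : LGPGaussianLogThetaLattice LogLink IsFull)
      {Frd : Type} {IsoF : Frd → Frd → Type} {Ob : Frd → Type} {realify : Frd → Frd} {Strip : Type}
      {IsoS : Strip → Strip → Type} {Mv : ∀ v : (thetaIndexOfInitial T.D).V, v ∈ (thetaIndexOfInitial T.D).Vbad → Type}
      [∀ v h, Monoid (Mv v h)]
      (sig : GlobalLGPFrobenioidSignature (thetaIndexOfInitial T.D).lstar (thetaIndexOfInitial T.D).V
        (· ∈ (thetaIndexOfInitial T.D).Vbad) Frd IsoF Ob realify Strip IsoS Mv)
      (split : SplittingMonoids Mv) {ObΔ : Type} {N : ∀ v : (thetaIndexOfInitial T.D).V, v ∈ (thetaIndexOfInitial T.D).Vbad → Type}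
      [∀ v h, Monoid (N v h)] (qData : QPilotData ObΔ N)
      (qK : ∀ v : (thetaIndexOfInitial T.D).V, v ∈ (thetaIndexOfInitial T.D).Vbad →
        Set ((logShellsOfInitialDH T.D (analyticLogvVal T.K)).StarPacket v)),
      ¬ Cor312Vol.PilotKummerCompatHull
        (LatticeSituation.ofShells (logShellsOfInitialDH T.D (analyticLogvVal T.K)) M archPk archSub
          (summandPiecesPrM T.D (logvAnalyticVal_analyticLogvVal (K := T.K))).Adm (summandPiecesPrM T.D (logvAnalyticVal_analyticLogvVal (K := T.K))).logvol Ψ act Mmod region frobAdm frobLogvol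
          frobΨ frobMmod unitImage ballImage thetaDiv)
        (settingPrVolSharpM T.D (logvAnalyticVal_analyticLogvVal (K := T.K)) (tOfIdeleData T.D (ideleDataOf T.D T.isVolumeInputOf))
          (fun u x => tqM T.D (ratChar u) u (natCast_ratChar_mem u) (ideleDataOf T.D T.isVolumeInputOf) x) M archPk archSub Ψ act Mmod region n lat sig split qData
          (fun u x => tqM_ne_zero T.D (ratChar u) u (natCast_ratChar_mem u) (ideleDataOf T.D T.isVolumeInputOf) x)
          (GenuineM.finite_ratPlaces_under_S T.D).toFinset
          (fun u x hu => norm_tqM_eq_one_of_not_mem T.D (ratChar u) u (natCast_ratChar_mem u) (ideleDataOf T.D T.isVolumeInputOf) x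
            fun hx => hu ((Set.Finite.mem_toFinset _).mpr ⟨x, hx⟩)))
        (fun _ => Cor312.Setting.qRegion
          (settingPrVolSharpM T.D (logvAnalyticVal_analyticLogvVal (K := T.K)) (tOfIdeleData T.D (ideleDataOf T.D T.isVolumeInputOf))
          (fun u x => tqM T.D (ratChar u) u (natCast_ratChar_mem u) (ideleDataOf T.D T.isVolumeInputOf) x) M archPk archSub Ψ act Mmod region n lat sig split qData
          (fun u x => tqM_ne_zero T.D (ratChar u) u (natCast_ratChar_mem u) (ideleDataOf T.D T.isVolumeInputOf) x)
          (GenuineM.finite_ratPlaces_under_S T.D).toFinset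
          (fun u x hu => norm_tqM_eq_one_of_not_mem T.D (ratChar u) u (natCast_ratChar_mem u) (ideleDataOf T.D T.isVolumeInputOf) x
            fun hx => hu ((Set.Finite.mem_toFinset _).mpr ⟨x, hx⟩)))) qK := by
  have hodd : Odd l := hl.odd_of_ne_two (by omega)
  have hfac : (3 ^ 4 * 23 ^ 6 * 1013 ^ 2 * (2 ^ 47 * 5 ^ 3 * 19 ^ 2) * (7 * 131 ^ 7 * 1373)).factorization 131 = 7 := by
    have hp : Nat.Prime 131 := by norm_num
    have hn : 3 ^ 4 * 23 ^ 6 * 1013 ^ 2 * (2 ^ 47 * 5 ^ 3 * 19 ^ 2) * (7 * 131 ^ 7 * 1373) = 131 ^ 7 * 751045959580342228580188759844192256000 := by norm_num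
    have hm : ¬ 131 ∣ 751045959580342228580188759844192256000 := by norm_num
    show (3 ^ 4 * 23 ^ 6 * 1013 ^ 2 * (2 ^ 47 * 5 ^ 3 * 19 ^ 2) * (7 * 131 ^ 7 * 1373)).factorization 131 = 7
    rw [hn, Nat.factorization_mul (pow_ne_zero _ hp.ne_zero) (by norm_num), Finsupp.add_apply, hp.factorization_pow,
      Finsupp.single_eq_same, Nat.factorization_eq_zero_of_not_dvd hm, add_zero]
  exact GenuineM.not_pilotKummerCompatHull_triple_of_hullCells_tameSharp isABCTriple_frey12304697054518521 T (placeOfPrimeQ 131 (by norm_num)) 131 (ratChar_placeOfPrimeQ 131 (by norm_num)) (by norm_num) (by norm_num)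
    (by norm_num) (show (131 : ℕ) ≠ l by omega) (by norm_num) hfac (i := (l - 1) / 2 - 1) (by omega)
    (fun A hA30 hA15 hAev _ _ => RefBand.cells_12304697054518521 hlo hhi hodd (by omega) A hA30 hA15 hAev)

end Summit.ABC.IUTFork.Conditional

end
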